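import Mathlib
import HarnessLib
import Summits.HubbardSuperconductivity.HubbardSuperconductivity.Theorems.KLProgrammePerturbedFermiCurveHigherDerivs

/-!
# Route `KLProgramme` — TWO polar level curves: the Lipschitz dependence of the radius tower on the level function,
# orders one and two (pointwise algebra on a normed space; the base of the (E3a-MS) slot decomposition)

Cell `gate-hubbard-kl`, seat hubbard-kl-k3c3-p3 (g3; row «implicit-function / monotonicity route»).  For the ENGINE child's two-leg stubs
(stmt-HubbardSuperconductivity-19855), clause (E3a-MS) `TwoLegSizesMST`: the slot-`m` part of the scale-`n` piece is a DIFFERENCE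
`F ∘ γ_{K^{(m)}} − F ∘ γ_{K^{(m−1)}}` of one increment read on the curves of two nearby frames (HOME/hubbard-kl-k3c3-p3/MS-CUT.md §3), so its
sizes need `|v^{(i)}(θ) − u^{(i)}(θ)|` for the radii `u, v` of the polar curves of two level functions `e, e'` at the same angle, in terms of
the differences of their derivatives at the two curve points.  This module is the pointwise algebra, orders 1–2 (3–4 follow the same
pattern in a companion file):

* §1 `abs_sub_of_two_solves`: if `s·(A d) = −T`, `s̃·(Ã d) = −T̃`, `A d, Ã d ≥ ρ₀ > 0`, then `|s̃ − s| ≤ (|T̃ − T| + |s|·|Ã d − A d|)/ρ₀`;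
  difference lemmas for (bi)linear evaluations `|Ã x̃ − A x|`, `|Ã x̃ ỹ − A x y|`.
* §2 `abs_deriv_sub_le_of_polar_levels` (order 1) and `abs_deriv_two_sub_le_of_polar_levels` (order 2): for `C⁴` `e, e'` with polar curves
  `u•dir`, `v•dir` in their level sets, at `θ`: with `W₀ ≥ |v − u|`, `Δ₁ ≥ ‖De'(ṽ) − De(p)‖`, `Δ₂ ≥ ‖D²e'(ṽ) − D²e(p)‖` (`p = u θ•dir θ`,
  `ṽ = v θ•dir θ`), common bounds `E₁, E₂` on the derivatives, `U₀` on the radii, `R₁, R₂` on `|u′|,|v′|,|u″|`, and `W₁ ≥ |v′ − u′|`: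
  `|v′ − u′| ≤ (E₁W₀ + (U₀ + R₁)Δ₁)/ρ₀`,
  `|v″ − u″| ≤ W₀ + (Δ₂K₁² + 2E₂K₁(W₁ + W₀) + Δ₁(2R₁ + U₀) + E₁(W₀ + 2W₁) + (R₂ + U₀)Δ₁)/ρ₀` (`K₁ = R₁ + U₀`).
  (In the application `Δ_j ≤ L_{j+1}·W₀ + ‖Dʲη‖`, `e' = e + η`, `L_{j+1} = sup ‖D^{j+1}e‖` — affine in the perturbation `η`.)

Everything is PROVED; no definitions; nothing about the Hubbard model.  References: BGM 2006 §2.4 Lemma 2.1 (2.40)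
[cite: BenfattoGiulianiMastropietro2006]; FST IV (CPAM 53 (2000) 1350) Thm 2 (Lipschitz dependence of the counterterm curve).
-/

noncomputable section

namespace Summit.HubbardSuperconductivity.HubbardSuperconductivity.Theorems.PerturbedFermiCurve

set_option linter.dupNamespace false -- summit = problem name (single-conjunct summit), D-0017
set_option maxSynthPendingDepth 3 -- nested operator-norm instances (second Fréchet derivatives)

open Real Set
open Literature.MathematicalPhysics.QuantumLattice Literature.MathematicalPhysics.QuantumLattice.BandSectorCounting

/-! ## §1 Pointwise algebra: two solves, (bi)linear differences -/

section Algebra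

variable {V : Type*} [NormedAddCommGroup V] [NormedSpace ℝ V]

/-- **Two radial solves.**  If `s·(A d) = −T` and `s̃·(Ã d) = −T̃` with `A d, Ã d ≥ ρ₀ > 0`, then
`|s̃ − s| ≤ (|T̃ − T| + |s|·|Ã d − A d|)/ρ₀` (`s̃ − s = −(T̃ − T)/(Ã d) − s·(Ã d − A d)/(Ã d)`; only `Ã d ≥ ρ₀` is used). [folklore] -/
theorem abs_sub_of_two_solves {A Ã : V →L[ℝ] ℝ} {d : V} {s s' T T' ρ₀ : ℝ} (h : s * A d = -T) (h' : s' * Ã d = -T')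
    (hρ' : ρ₀ ≤ Ã d) (hρ0 : 0 < ρ₀) :
    |s' - s| ≤ (|T' - T| + |s| * |Ã d - A d|) / ρ₀ := by
  have hÃ : 0 < Ã d := hρ0.trans_le hρ'
  have key : (s' - s) * Ã d = -(T' - T) - s * (Ã d - A d) := by
    have : s' * Ã d - s * Ã d = -T' + T - s * (Ã d - A d) := by rw [h']; linarith [h]
    linarith
  rw [le_div_iff₀ hρ0]
  have h1 : |s' - s| * ρ₀ ≤ |s' - s| * Ã d := mul_le_mul_of_nonneg_left hρ' (abs_nonneg _)
  have h2 : |s' - s| * Ã d = |-(T' - T) - s * (Ã d - A d)| := by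
    rw [← key, abs_mul, abs_of_pos hÃ]
  have h3 : |-(T' - T) - s * (Ã d - A d)| ≤ |T' - T| + |s| * |Ã d - A d| := by
    calc _ ≤ |-(T' - T)| + |s * (Ã d - A d)| := abs_sub _ _
      _ = |T' - T| + |s| * |Ã d - A d| := by rw [abs_neg, abs_mul]
  linarith

/-- **Linear difference**: `|Ã x̃ − A x| ≤ ‖Ã − A‖·‖x̃‖ + ‖A‖·‖x̃ − x‖`. [folklore] -/
theorem abs_apply_sub_apply_le (A Ã : V →L[ℝ] ℝ) (x x' : V) :
    |Ã x' - A x| ≤ ‖Ã - A‖ * ‖x'‖ + ‖A‖ * ‖x' - x‖ := by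
  have e : Ã x' - A x = (Ã - A) x' + A (x' - x) := by
    simp only [sub_apply, map_sub]; ring
  rw [e]
  refine (abs_add_le _ _).trans (add_le_add ?_ ?_)
  · rw [← Real.norm_eq_abs]; exact (Ã - A).le_opNorm x'
  · rw [← Real.norm_eq_abs]; exact A.le_opNorm (x' - x)

/-- **Bilinear difference**: `|Ã x̃ ỹ − A x y| ≤ ‖Ã − A‖·‖x̃‖·‖ỹ‖ + ‖A‖·(‖x̃ − x‖·‖ỹ‖ + ‖x‖·‖ỹ − y‖)`. [folklore] -/
theorem abs_apply₂_sub_apply₂_le (A Ã : V →L[ℝ] V →L[ℝ] ℝ) (x x' y y' : V) :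
    |Ã x' y' - A x y| ≤ ‖Ã - A‖ * ‖x'‖ * ‖y'‖ + ‖A‖ * (‖x' - x‖ * ‖y'‖ + ‖x‖ * ‖y' - y‖) := by
  have e : Ã x' y' - A x y = (Ã - A) x' y' + A (x' - x) y' + A x (y' - y) := by
    simp only [sub_apply, map_sub]; ring
  rw [e]
  have h1 : |(Ã - A) x' y'| ≤ ‖Ã - A‖ * ‖x'‖ * ‖y'‖ := abs_apply₂_le_of_opNorm_le _ le_rfl _ _
  have h2 : |A (x' - x) y'| ≤ ‖A‖ * ‖x' - x‖ * ‖y'‖ := abs_apply₂_le_of_opNorm_le _ le_rfl _ _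
  have h3 : |A x (y' - y)| ≤ ‖A‖ * ‖x‖ * ‖y' - y‖ := abs_apply₂_le_of_opNorm_le _ le_rfl _ _
  calc _ ≤ |(Ã - A) x' y' + A (x' - x) y'| + |A x (y' - y)| := abs_add_le _ _
    _ ≤ |(Ã - A) x' y'| + |A (x' - x) y'| + |A x (y' - y)| := by linarith [abs_add_le ((Ã - A) x' y') (A (x' - x) y')]
    _ ≤ _ := by nlinarith

end Algebra

/-! ## §2 Two polar level curves: orders one and two -/

section TwoPolar

variable {e e' : (Fin 2 → ℝ) → ℝ} (he : ContDiff ℝ 4 e) (he' : ContDiff ℝ 4 e') {u v : ℝ → ℝ} (hu : ContDiff ℝ 4 u)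
  (hv : ContDiff ℝ 4 v) {c c' : ℝ} (hlev : ∀ ϑ, e (u ϑ • dir ϑ) = c) (hlev' : ∀ ϑ, e' (v ϑ • dir ϑ) = c')
include he he' hu hv hlev hlev'

/-- **Order 1, two curves.**  At the angle `θ`, with `p = u θ•dir θ`, `ṽ = v θ•dir θ`: transversality `De(p)[dir θ], De'(ṽ)[dir θ] ≥ ρ₀ > 0`,
`‖De'(ṽ)‖ ≤ E₁`, `‖De'(ṽ) − De(p)‖ ≤ Δ₁`, `|u θ| ≤ U₀`, `|u′ θ| ≤ R₁`, `|v θ − u θ| ≤ W₀`: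
`|v′ θ − u′ θ| ≤ (E₁·W₀ + (U₀ + R₁)·Δ₁)/ρ₀`.  [cite: BenfattoGiulianiMastropietro2006, §2.4 Lemma 2.1 (2.40)] -/
theorem abs_deriv_sub_le_of_polar_levels {θ ρ₀ E₁ Δ₁ U₀ R₁ W₀ : ℝ} (hρ0 : 0 < ρ₀)
    (hρ' : ρ₀ ≤ fderiv ℝ e' (v θ • dir θ) (dir θ))
    (hE₁' : ‖fderiv ℝ e' (v θ • dir θ)‖ ≤ E₁)
    (hΔ₁ : ‖fderiv ℝ e' (v θ • dir θ) - fderiv ℝ e (u θ • dir θ)‖ ≤ Δ₁)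
    (hU₀ : |u θ| ≤ U₀) (hR₁ : |deriv u θ| ≤ R₁) (hW₀ : |v θ - u θ| ≤ W₀) :
    |deriv v θ - deriv u θ| ≤ (E₁ * W₀ + (U₀ + R₁) * Δ₁) / ρ₀ := by
  have hid := level_chain_one (k₀ := fun t => u t • dir t) (he.of_le (by norm_num)) hlev (hasDerivAt_polar_zero hu) θ
  have hid' := level_chain_one (k₀ := fun t => v t • dir t) (he'.of_le (by norm_num)) hlev' (hasDerivAt_polar_zero hv) θ
  set A := fderiv ℝ e (u θ • dir θ) with hA
  set Ã := fderiv ℝ e' (v θ • dir θ) with hÃ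
  set d₀ := dir θ with hd₀
  set d₁ := dir (θ + π / 2) with hd₁
  clear_value A Ã d₀ d₁
  have hAu : A (deriv u θ • d₀ + u θ • d₁) = deriv u θ * A d₀ + u θ * A d₁ := by
    simp only [map_add, map_smul, smul_eq_mul]
  have hAv : Ã (deriv v θ • d₀ + v θ • d₁) = deriv v θ * Ã d₀ + v θ * Ã d₁ := by
    simp only [map_add, map_smul, smul_eq_mul]
  -- `u′·(A d₀) = −(u·A d₁)`, `v′·(Ã d₀) = −(v·Ã d₁)`
  have h : deriv u θ * A d₀ = -(u θ * A d₁) := by linarith [hid, hAu]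
  have h' : deriv v θ * Ã d₀ = -(v θ * Ã d₁) := by linarith [hid', hAv]
  have hsol := abs_sub_of_two_solves h h' hρ' hρ0
  have hΔ0 : 0 ≤ Δ₁ := (norm_nonneg _).trans hΔ₁
  have hE0 : 0 ≤ E₁ := (norm_nonneg _).trans hE₁'
  have hR0 : 0 ≤ R₁ := (abs_nonneg _).trans hR₁
  have hU0 : 0 ≤ U₀ := (abs_nonneg _).trans hU₀
  have hnd₁ : ‖d₁‖ ≤ 1 := hd₁ ▸ norm_dir_le_one _
  have hnd₀ : ‖d₀‖ ≤ 1 := hd₀ ▸ norm_dir_le_one _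
  have h1 : |Ã d₁| ≤ E₁ :=
    (abs_apply_le_of_opNorm_le _ hE₁' _).trans (mul_le_of_le_one_right hE0 hnd₁)
  have h2 : |Ã d₁ - A d₁| ≤ Δ₁ := by
    rw [← sub_apply]; exact (abs_apply_le_of_opNorm_le _ hΔ₁ _).trans (mul_le_of_le_one_right hΔ0 hnd₁)
  have hdd : |Ã d₀ - A d₀| ≤ Δ₁ := by
    rw [← sub_apply]; exact (abs_apply_le_of_opNorm_le _ hΔ₁ _).trans (mul_le_of_le_one_right hΔ0 hnd₀)
  -- `|T̃ − T| ≤ W₀·E₁ + U₀·Δ₁`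
  have hT : |v θ * Ã d₁ - u θ * A d₁| ≤ W₀ * E₁ + U₀ * Δ₁ := by
    have e1 : v θ * Ã d₁ - u θ * A d₁ = (v θ - u θ) * Ã d₁ + u θ * (Ã d₁ - A d₁) := by ring
    rw [e1]
    have i1 : |(v θ - u θ) * Ã d₁| ≤ W₀ * E₁ := by
      rw [abs_mul]; exact mul_le_mul hW₀ h1 (abs_nonneg _) ((abs_nonneg _).trans hW₀)
    have i2 : |u θ * (Ã d₁ - A d₁)| ≤ U₀ * Δ₁ := by
      rw [abs_mul]; exact mul_le_mul hU₀ h2 (abs_nonneg _) hU0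
    exact abs_add_le_add i1 i2
  have hs : |deriv u θ| * |Ã d₀ - A d₀| ≤ R₁ * Δ₁ := mul_le_mul hR₁ hdd (abs_nonneg _) hR0
  calc |deriv v θ - deriv u θ| ≤ (|v θ * Ã d₁ - u θ * A d₁| + |deriv u θ| * |Ã d₀ - A d₀|) / ρ₀ := hsol
    _ ≤ (E₁ * W₀ + (U₀ + R₁) * Δ₁) / ρ₀ := div_le_div_of_nonneg_right (by linarith) hρ0.le

/-- **Order 2, two curves.**  In addition to the order-1 data: `‖De(p)‖ ≤ E₁`, `‖D²e(p)‖ ≤ E₂` (FIRST curve only), `‖D²e'(ṽ) − D²e(p)‖ ≤ Δ₂`,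
`|v θ| ≤ U₀`, `|v′ θ| ≤ R₁`, `|u″ θ| ≤ R₂`, `|v′ θ − u′ θ| ≤ W₁`; with `K₁ = R₁ + U₀`:
`|v″ θ − u″ θ| ≤ W₀ + (Δ₂K₁² + 2E₂K₁(W₁ + W₀) + Δ₁(2R₁ + U₀) + E₁(W₀ + 2W₁) + (R₂ + U₀)Δ₁)/ρ₀`.
[cite: BenfattoGiulianiMastropietro2006, §2.4 Lemma 2.1 (2.40)] -/
theorem abs_deriv_two_sub_le_of_polar_levels {θ ρ₀ E₁ E₂ Δ₁ Δ₂ U₀ R₁ R₂ W₀ W₁ : ℝ} (hρ0 : 0 < ρ₀)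
    (hρ' : ρ₀ ≤ fderiv ℝ e' (v θ • dir θ) (dir θ))
    (hE₁ : ‖fderiv ℝ e (u θ • dir θ)‖ ≤ E₁) (hE₂ : ‖fderiv ℝ (fderiv ℝ e) (u θ • dir θ)‖ ≤ E₂)
    (hΔ₁ : ‖fderiv ℝ e' (v θ • dir θ) - fderiv ℝ e (u θ • dir θ)‖ ≤ Δ₁)
    (hΔ₂ : ‖fderiv ℝ (fderiv ℝ e') (v θ • dir θ) - fderiv ℝ (fderiv ℝ e) (u θ • dir θ)‖ ≤ Δ₂)
    (hU₀ : |u θ| ≤ U₀) (hU₀' : |v θ| ≤ U₀) (hR₁ : |deriv u θ| ≤ R₁) (hR₁' : |deriv v θ| ≤ R₁)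
    (hR₂ : |deriv (deriv u) θ| ≤ R₂) (hW₀ : |v θ - u θ| ≤ W₀) (hW₁ : |deriv v θ - deriv u θ| ≤ W₁) :
    |deriv (deriv v) θ - deriv (deriv u) θ| ≤
      W₀ + (Δ₂ * (R₁ + U₀) ^ 2 + 2 * E₂ * (R₁ + U₀) * (W₁ + W₀) + Δ₁ * (2 * R₁ + U₀) + E₁ * (W₀ + 2 * W₁) +
        (R₂ + U₀) * Δ₁) / ρ₀ := by
  -- the two order-2 identities (created BEFORE the abbreviations so that `set` folds them)
  have hid := level_chain_two (k₀ := fun t => u t • dir t) (he.of_le (by norm_num)) hlev (hasDerivAt_polar_zero hu)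
    (hasDerivAt_polar_one hu) θ
  have hid' := level_chain_two (k₀ := fun t => v t • dir t) (he'.of_le (by norm_num)) hlev' (hasDerivAt_polar_zero hv)
    (hasDerivAt_polar_one hv) θ
  set A := fderiv ℝ e (u θ • dir θ) with hA
  set Ã := fderiv ℝ e' (v θ • dir θ) with hÃ
  set A₂ := fderiv ℝ (fderiv ℝ e) (u θ • dir θ) with hA₂
  set Ã₂ := fderiv ℝ (fderiv ℝ e') (v θ • dir θ) with hÃ₂
  set d₀ := dir θ with hd₀
  set d₁ := dir (θ + π / 2) with hd₁
  set k₁ := deriv u θ • d₀ + u θ • d₁ with hk₁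
  set k₁' := deriv v θ • d₀ + v θ • d₁ with hk₁'
  clear_value k₁ k₁' A Ã A₂ Ã₂
  have hfc : ∀ a b : ℝ, ‖a • d₀ + b • d₁‖ ≤ |a| + |b| := fun a b => by rw [hd₀, hd₁]; exact norm_frame_comb_le a b θ
  clear_value d₀ d₁
  have hnd₀ : ‖d₀‖ ≤ 1 := hd₀ ▸ norm_dir_le_one _
  have hnd₁ : ‖d₁‖ ≤ 1 := hd₁ ▸ norm_dir_le_one _
  -- solved forms: `u″·(A d₀) = −T`, `T = A₂[k₁,k₁] + A r`, `r = (−u)•d₀ + (2u′)•d₁`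
  have hAu : A ((deriv (deriv u) θ - u θ) • d₀ + (2 * deriv u θ) • d₁) =
      (deriv (deriv u) θ - u θ) * A d₀ + 2 * deriv u θ * A d₁ := by simp only [map_add, map_smul, smul_eq_mul]
  have hAr : A ((-u θ) • d₀ + (2 * deriv u θ) • d₁) = -u θ * A d₀ + 2 * deriv u θ * A d₁ := by
    simp only [map_add, map_smul, smul_eq_mul]
  have hAv : Ã ((deriv (deriv v) θ - v θ) • d₀ + (2 * deriv v θ) • d₁) =
      (deriv (deriv v) θ - v θ) * Ã d₀ + 2 * deriv v θ * Ã d₁ := by simp only [map_add, map_smul, smul_eq_mul]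
  have hAr' : Ã ((-v θ) • d₀ + (2 * deriv v θ) • d₁) = -v θ * Ã d₀ + 2 * deriv v θ * Ã d₁ := by
    simp only [map_add, map_smul, smul_eq_mul]
  have h : deriv (deriv u) θ * A d₀ = -(A₂ k₁ k₁ + A ((-u θ) • d₀ + (2 * deriv u θ) • d₁)) := by
    linarith [hid, hAu, hAr]
  have h' : deriv (deriv v) θ * Ã d₀ = -(Ã₂ k₁' k₁' + Ã ((-v θ) • d₀ + (2 * deriv v θ) • d₁)) := by
    linarith [hid', hAv, hAr']
  have hsol := abs_sub_of_two_solves h h' hρ' hρ0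
  -- nonnegativity bookkeeping
  have hΔ10 : 0 ≤ Δ₁ := (norm_nonneg _).trans hΔ₁
  have hΔ20 : 0 ≤ Δ₂ := (norm_nonneg _).trans hΔ₂
  have hE10 : 0 ≤ E₁ := (norm_nonneg _).trans hE₁
  have hE20 : 0 ≤ E₂ := (norm_nonneg _).trans hE₂
  have hU0 : 0 ≤ U₀ := (abs_nonneg _).trans hU₀
  have hR10 : 0 ≤ R₁ := (abs_nonneg _).trans hR₁
  have hW00 : 0 ≤ W₀ := (abs_nonneg _).trans hW₀
  have hW10 : 0 ≤ W₁ := (abs_nonneg _).trans hW₁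
  have hK0 : 0 ≤ R₁ + U₀ := by linarith
  -- sizes of the velocity vectors and their difference
  have hK₁ : ‖k₁‖ ≤ R₁ + U₀ := by rw [hk₁]; exact (hfc _ _).trans (by linarith)
  have hK₁' : ‖k₁'‖ ≤ R₁ + U₀ := by rw [hk₁']; exact (hfc _ _).trans (by linarith)
  have hdk : ‖k₁' - k₁‖ ≤ W₁ + W₀ := by
    have e1 : k₁' - k₁ = (deriv v θ - deriv u θ) • d₀ + (v θ - u θ) • d₁ := by
      rw [hk₁, hk₁', sub_smul, sub_smul]; abel
    rw [e1]; exact (hfc _ _).trans (by linarith)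
  -- the bilinear difference
  have hB : |Ã₂ k₁' k₁' - A₂ k₁ k₁| ≤ Δ₂ * (R₁ + U₀) ^ 2 + 2 * E₂ * (R₁ + U₀) * (W₁ + W₀) := by
    refine (abs_apply₂_sub_apply₂_le A₂ Ã₂ k₁ k₁' k₁ k₁').trans ?_
    have i1 : ‖Ã₂ - A₂‖ * ‖k₁'‖ * ‖k₁'‖ ≤ Δ₂ * (R₁ + U₀) * (R₁ + U₀) :=
      mul_le_mul (mul_le_mul hΔ₂ hK₁' (norm_nonneg _) hΔ20) hK₁' (norm_nonneg _) (mul_nonneg hΔ20 hK0)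
    have i2 : ‖k₁' - k₁‖ * ‖k₁'‖ ≤ (W₁ + W₀) * (R₁ + U₀) := mul_le_mul hdk hK₁' (norm_nonneg _) (by linarith)
    have i3 : ‖k₁‖ * ‖k₁' - k₁‖ ≤ (R₁ + U₀) * (W₁ + W₀) := mul_le_mul hK₁ hdk (norm_nonneg _) hK0
    have i4 : ‖A₂‖ * (‖k₁' - k₁‖ * ‖k₁'‖ + ‖k₁‖ * ‖k₁' - k₁‖) ≤ E₂ * ((W₁ + W₀) * (R₁ + U₀) + (R₁ + U₀) * (W₁ + W₀)) :=
      mul_le_mul hE₂ (add_le_add i2 i3) (by positivity) hE20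
    have e : Δ₂ * (R₁ + U₀) * (R₁ + U₀) + E₂ * ((W₁ + W₀) * (R₁ + U₀) + (R₁ + U₀) * (W₁ + W₀)) =
        Δ₂ * (R₁ + U₀) ^ 2 + 2 * E₂ * (R₁ + U₀) * (W₁ + W₀) := by ring
    linarith
  -- the linear difference: `r̃ − r = −(v−u)•d₀ + 2(v′−u′)•d₁`
  have hL : |Ã ((-v θ) • d₀ + (2 * deriv v θ) • d₁) - A ((-u θ) • d₀ + (2 * deriv u θ) • d₁)| ≤
      Δ₁ * (2 * R₁ + U₀) + E₁ * (W₀ + 2 * W₁) := by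
    refine (abs_apply_sub_apply_le A Ã _ _).trans ?_
    have hr' : ‖(-v θ) • d₀ + (2 * deriv v θ) • d₁‖ ≤ 2 * R₁ + U₀ := by
      refine (hfc _ _).trans ?_
      rw [abs_neg, abs_mul, abs_two]; linarith
    have hrr : ‖((-v θ) • d₀ + (2 * deriv v θ) • d₁) - ((-u θ) • d₀ + (2 * deriv u θ) • d₁)‖ ≤ W₀ + 2 * W₁ := by
      have e1 : ((-v θ) • d₀ + (2 * deriv v θ) • d₁) - ((-u θ) • d₀ + (2 * deriv u θ) • d₁) =
          (-(v θ - u θ)) • d₀ + (2 * (deriv v θ - deriv u θ)) • d₁ := by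
        simp only [sub_smul, neg_smul, mul_sub, neg_sub]; abel
      rw [e1]
      refine (hfc _ _).trans ?_
      rw [abs_neg, abs_mul, abs_two]; linarith
    have i1 : ‖Ã - A‖ * ‖(-v θ) • d₀ + (2 * deriv v θ) • d₁‖ ≤ Δ₁ * (2 * R₁ + U₀) :=
      mul_le_mul hΔ₁ hr' (norm_nonneg _) hΔ10
    have i2 : ‖A‖ * ‖((-v θ) • d₀ + (2 * deriv v θ) • d₁) - ((-u θ) • d₀ + (2 * deriv u θ) • d₁)‖ ≤ E₁ * (W₀ + 2 * W₁) :=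
      mul_le_mul hE₁ hrr (norm_nonneg _) hE10
    linarith
  -- `|T̃ − T|`
  have hT : |Ã₂ k₁' k₁' + Ã ((-v θ) • d₀ + (2 * deriv v θ) • d₁) - (A₂ k₁ k₁ + A ((-u θ) • d₀ + (2 * deriv u θ) • d₁))| ≤
      Δ₂ * (R₁ + U₀) ^ 2 + 2 * E₂ * (R₁ + U₀) * (W₁ + W₀) + (Δ₁ * (2 * R₁ + U₀) + E₁ * (W₀ + 2 * W₁)) := by
    have e1 : Ã₂ k₁' k₁' + Ã ((-v θ) • d₀ + (2 * deriv v θ) • d₁) - (A₂ k₁ k₁ + A ((-u θ) • d₀ + (2 * deriv u θ) • d₁)) =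
        (Ã₂ k₁' k₁' - A₂ k₁ k₁) + (Ã ((-v θ) • d₀ + (2 * deriv v θ) • d₁) - A ((-u θ) • d₀ + (2 * deriv u θ) • d₁)) := by ring
    rw [e1]; exact abs_add_le_add hB hL
  have hdd : |Ã d₀ - A d₀| ≤ Δ₁ := by
    rw [← sub_apply]; exact (abs_apply_le_of_opNorm_le _ hΔ₁ _).trans (mul_le_of_le_one_right hΔ10 hnd₀)
  have hs : |deriv (deriv u) θ| * |Ã d₀ - A d₀| ≤ (R₂ + U₀) * Δ₁ :=
    mul_le_mul (by linarith [hR₂]) hdd (abs_nonneg _) (by linarith [abs_nonneg (deriv (deriv u) θ)])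
  have hmain : |deriv (deriv v) θ - deriv (deriv u) θ| ≤
      (Δ₂ * (R₁ + U₀) ^ 2 + 2 * E₂ * (R₁ + U₀) * (W₁ + W₀) + Δ₁ * (2 * R₁ + U₀) + E₁ * (W₀ + 2 * W₁) +
        (R₂ + U₀) * Δ₁) / ρ₀ :=
    hsol.trans (div_le_div_of_nonneg_right (by linarith) hρ0.le)
  linarith

end TwoPolar

end Summit.HubbardSuperconductivity.HubbardSuperconductivity.Theorems.PerturbedFermiCurve

end
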